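import Literature.NumberTheory.Automorphic.KimExteriorSquareGL4Twist
import Literature.NumberTheory.Automorphic.AutomorphicRepsGLCleanModel
import Literature.NumberTheory.Automorphic.IdeleNormDetGL
import HarnessLib

/-!
# Kim's exterior square `GL₄ → GL₆`: reduction of the fact to Kim's printed hypothesis
# (clean, `A_G`-invariant — i.e. unitary-normalised — cuspidal data)

Sibling proof file (one theorem; no `sorry`, no definition, no named fact) of
`Literature.NumberTheory.Automorphic.KimExteriorSquareGL4`, in support of the named fact
`Kim2003_exteriorSquare_GL4` (H. H. Kim, J. Amer. Math. Soc. **16** (2003), Thm. A p. 139 =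
Thm. 4.2.3 p. 156 / Thm. 5.3.1 p. 165 [Kim2002]).

The tree's fact quantifies over **every** cuspidal Borel–Jacquet datum `π = W / W'` on `GL₄(𝔸_F)`
(no condition at the split component `A_G = ℝ_{>0}` of the centre, `W'` arbitrary), whereas Kim's
theorem is printed for (unitary) cuspidal automorphic representations (p. 139: "a cuspidal
representation always means a unitary one"). The module docstring of `KimExteriorSquareGL4`
justifies the rendering by the normalisation `π = π⁰ ⊗ |det|^s`; this file PROVES that reduction
inside the tree:

* `Kim2003_exteriorSquare_GL4_of_clean_centralInvariant` — granted the semisimplicity of the space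
  of `A_G`-invariant cusp forms (the existing named fact
  `AutomorphicRepsGL.stable_cuspidal_eq_sSup_irreducible`, Gelfand–Piatetski-Shapiro /
  Borel–Jacquet 1979, 4.6 / Getz–Hahn 2024, Cor. 9.1.2, taken as a hypothesis), the fact
  `Kim2003_exteriorSquare_GL4` follows from its special case of **clean** (`W' = ⊥`) cuspidal data
  whose forms are **`A_G`-invariant** — irreducible spaces of cusp forms on
  `GL₄(F) A_G \ GL₄(𝔸_F)`, i.e. the `K_∞`-finite smooth vectors of irreducible constituents of
  `L²_cusp(GL₄(F) A_G \ GL₄(𝔸_F))`, the unitary cuspidal automorphic representations of Kim's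
  statement (Borel–Jacquet 1979, 4.6; `exists_isAssociatedL2` of `AutomorphicRepsGL`).

The proof assembles accepted results of the tree: every cuspidal `π` has the Satake parameters of a
clean cuspidal `π₀` (`CuspidalAutomorphicRepData.exists_clean_hasSatakeParamAt_of_sSup_irreducible`,
file `AutomorphicRepsGLCleanModel` — the true form of the refuted `cuspidal_W'_eq_bot`), hence is
nearly equivalent to it (`AutomorphicRepData.hasSatakeParamAt_cofinite_holds`); `A_G` acts on the
clean `π₀` by `a ↦ a^μ` (`AutomorphicRepData.exists_apply_posRealScalar_mul_eq_cpow`, file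
`AutomorphicRepDataSplitCenter`); twisting by the idèle class character `‖·‖^s`,
`s · 4[F:ℚ] = -μ` (`exists_heckeCharacter_ideleNorm_cpow`, `exists_cuspidalAutomorphicRepData_twist_hecke`,
`mulChar_detTwist_apply_posRealScalar_mul_of_cpow`) yields a clean `A_G`-invariant cuspidal `π₁`;
the conclusion of Theorem A for `π₁` transfers back to `π₀ = π₁ ⊗ ‖det‖^{-s}` and to `π` by the
invariance theorems of `KimExteriorSquareGL4Twist` (`conclusion_of_twist`,
`conclusion_of_isNearlyEquivalent`). Borel–Jacquet 1979, 5.7 ("we may assume `π` unitary").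

Together with `AutomorphicRepOfForm` (an eigenform on `GL₆` yields the `P` of clause (i)) this
isolates what remains of `Kim2003_exteriorSquare_GL4_holds`: for a unitary-normalised cuspidal `π`
on `GL₄(𝔸_F)`, the existence of an automorphic Hecke eigenform on `GL₆(𝔸_F)` with the eigenvalues
of `∧² t_{π,v}` at almost all `v` (Kim §§2–4: converse theorem + Langlands–Shahidi method) and the
isobaric clause ((4.1), p. 154) — analytic inputs with no carrier in the tree.

## References

* [Kim2002] H. H. Kim, J. Amer. Math. Soc. 16 (2003): p. 139 (convention), Thm. 4.2.3 (p. 156).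
* A. Borel, H. Jacquet, Corvallis (1979), Part 1, §4.6, 5.7 [BorelJacquetCorvallis1979],
  [BorelJacquet1979].
* J. R. Getz, H. Hahn, *An Introduction to Automorphic Representations*, GTM 300 (2024), Thm. 6.5.1,
  Cor. 9.1.2 [GetzHahn2024].
-/

noncomputable section

open scoped MatrixGroups Classical NumberField
open NumberField IsDedekindDomain Filter
open Literature.NumberTheory.GaloisRepresentations (HeckeCharacter)

namespace Literature.NumberTheory.Automorphic

/-! ### Reduction of the fact to clean, `A_G`-invariant cuspidal data (Kim's printed hypothesis) -/

section Reduction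

open scoped NNReal

/-- **`Kim2003_exteriorSquare_GL4` follows from its case of clean, `A_G`-invariant cuspidal data**
(the tree's rendering "for every cuspidal Borel–Jacquet datum `π`" reduced to Kim's printed
hypothesis "`π` a (unitary) cuspidal automorphic representation", p. 139), granted the
semisimplicity of the space of `A_G`-invariant cusp forms (the named fact
`AutomorphicRepsGL.stable_cuspidal_eq_sSup_irreducible`; Gelfand–Piatetski-Shapiro, Borel–Jacquet
1979, 4.6). A clean `A_G`-invariant cuspidal datum `W / ⊥` on `GL₄(𝔸_F)` is an irreducible space of
cusp forms on `GL₄(F) A_G \ GL₄(𝔸_F)`, i.e. (the smooth vectors of) an irreducible constituent of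
`L²_cusp` — a unitary cuspidal automorphic representation in Kim's sense. Proof: a cuspidal `π` has
the Satake parameters of a clean cuspidal `π₀`
(`CuspidalAutomorphicRepData.exists_clean_hasSatakeParamAt_of_sSup_irreducible`), so `π₀` and `π`
are nearly equivalent (`hasSatakeParamAt_cofinite_holds`); `A_G` acts on `π₀` by `a ↦ a^μ`
(`AutomorphicRepData.exists_apply_posRealScalar_mul_eq_cpow`), so the twist
`π₁ = π₀ ⊗ ‖det‖^{-μ/4[F:ℚ]}` (`exists_heckeCharacter_ideleNorm_cpow`,
`exists_cuspidalAutomorphicRepData_twist_hecke`, `mulChar_detTwist_apply_posRealScalar_mul_of_cpow`)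
is clean and `A_G`-invariant; the hypothesis gives the conclusion for `π₁`, which transfers to
`π₀ = π₁ ⊗ ‖det‖^{μ/4[F:ℚ]}` (`conclusion_of_twist`) and to `π` (`conclusion_of_isNearlyEquivalent`).
Borel–Jacquet 1979, 5.7 ("we may assume `π` unitary"); Kim 2003, p. 139.
[cite: Kim2002, §1 p. 139 (convention "cuspidal = unitary cuspidal")] -/
theorem Kim2003_exteriorSquare_GL4_of_clean_centralInvariant
    (hss : ∀ (F : Type) [Field F] [NumberField F] (h4 : isCompact_glFiniteIntegralLevel 4 F),
      AutomorphicRepsGL.stable_cuspidal_eq_sSup_irreducible h4)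
    (H : ∀ (F : Type) [Field F] [NumberField F] (hF : ∀ m : ℕ, isCompact_glFiniteIntegralLevel m F)
      (π : CuspidalAutomorphicRepData 4 F (hF 4)), π.1.W' = ⊥ →
      (∀ φ ∈ π.1.W, ∀ z ∈ (AdelicGroupData.gl 4 F).center', ∀ g, φ (z * g) = φ g) →
      ∃ P : AutomorphicRepData (AutomorphyDatum.gl 6 F (hF 6)),
        (∀ᶠ v : HeightOneSpectrum (𝓞 F) in cofinite, ∀ α : Multiset ℂ,
          π.1.HasSatakeParamAt v α → P.HasSatakeParamAt v (wedgeTwoParams α)) ∧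
        ∃ (k : ℕ) (m : Fin k → ℕ) (σ : ∀ i : Fin k, CuspidalAutomorphicRepData (m i) F (hF (m i))),
          (∑ i, m i = 6) ∧
          ∀ᶠ v : HeightOneSpectrum (𝓞 F) in cofinite, ∀ β : Fin k → Multiset ℂ,
            (∀ i, (σ i).1.HasSatakeParamAt v (β i)) → P.HasSatakeParamAt v (∑ i, β i)) :
    Kim2003_exteriorSquare_GL4 := by
  intro F _ _ hF π
  -- (1) a clean cuspidal datum `π₀` with the Satake parameters of `π`, hence nearly equivalent to `π`
  obtain ⟨π₀, hπ₀, hincl⟩ :=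
    CuspidalAutomorphicRepData.exists_clean_hasSatakeParamAt_of_sSup_irreducible (hss F (hF 4)) π
  have hne : AutomorphicRepData.IsNearlyEquivalent π₀.1 π.1 := by
    filter_upwards [AutomorphicRepData.hasSatakeParamAt_cofinite_holds π₀.1] with v hv
    obtain ⟨β, hβ⟩ := hv
    exact ⟨β, hβ, hincl v β hβ⟩
  -- (2) `A_G` acts on `π₀` by `a ↦ a^μ`
  obtain ⟨μ, hμ⟩ := π₀.1.exists_apply_posRealScalar_mul_eq_cpow hπ₀
  -- (3) the norm-power character `‖·‖^s`, `s · 4[F:ℚ] = -μ`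
  have hd : ((4 * Module.finrank ℚ F : ℕ) : ℂ) ≠ 0 := by
    exact_mod_cast mul_ne_zero four_ne_zero Module.finrank_pos.ne'
  set s : ℂ := -μ / ((4 * Module.finrank ℚ F : ℕ) : ℂ) with hsdef
  have hs : s * ((4 * Module.finrank ℚ F : ℕ) : ℂ) = -μ := by
    rw [hsdef, div_mul_cancel₀ _ hd]
  obtain ⟨χ, hχ⟩ := exists_heckeCharacter_ideleNorm_cpow F s
  -- (4) the twist `π₁ = π₀ ⊗ (χ ∘ det)`: clean and `A_G`-invariant
  obtain ⟨π₁, hW₁, hW₁'⟩ := exists_cuspidalAutomorphicRepData_twist_hecke χ π₀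
  have hπ₁ : π₁.1.W' = ⊥ := by rw [hW₁', hπ₀, Submodule.map_bot]
  have hinv : ∀ φ ∈ π₁.1.W, ∀ z ∈ (AdelicGroupData.gl 4 F).center', ∀ g, φ (z * g) = φ g := by
    intro φ hφ z hz g
    rw [hW₁] at hφ
    obtain ⟨φ₀, hφ₀, rfl⟩ := Submodule.mem_map.1 hφ
    rw [AdelicGroupData.gl_center'] at hz
    obtain ⟨t, rfl⟩ := MonoidHom.mem_range.1 hz
    exact mulChar_detTwist_apply_posRealScalar_mul_of_cpow hχ hs (hμ φ₀ hφ₀) t g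
  -- (5) Theorem A for `π₁`, transported back to `π₀ = π₁ ⊗ (χ⁻¹ ∘ det)` and to `π`
  have h₁ := H F hF π₁ hπ₁ hinv
  have hWs : π₀.1.W = π₁.1.W.map (mulChar (detTwist 4 χ⁻¹)) := by
    rw [hW₁, detTwist_inv, map_mulChar_inv_map_mulChar]
  have hW's : π₀.1.W' = π₁.1.W'.map (mulChar (detTwist 4 χ⁻¹)) := by
    rw [hW₁', detTwist_inv, map_mulChar_inv_map_mulChar]
  exact Kim2003_exteriorSquare_GL4.conclusion_of_isNearlyEquivalent F hF hne
    (Kim2003_exteriorSquare_GL4.conclusion_of_twist F hF χ⁻¹ hWs hW's h₁)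

end Reduction

end Literature.NumberTheory.Automorphic

end
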